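import Summits.Ventures.HodgeRepro2.T5SU11KernelPowerSeries
import Summits.Ventures.HodgeRepro2.T5SU11KernelTaylor
import Summits.Ventures.HodgeRepro2.T5SU11KernelIteratedDerivative

/-!
# Summary XXI — the kernel as an analytic function of the spectral parameter: power series, Taylor remainder, the
derivative of the composed kernels, the iterated derivatives (rows 577–580), under uniform names

Throughout `μ = λ(λ − 2)`, `λ(μ) = 1 + √(μ + 1)`, `K_λ` the kernel of `G^I_λ`, and `K_λ^{∘(n+1)}(t, s) = (G^I_λ)ⁿ K_λ(·, s)(t)`
the composed kernels.

* `kernel_summable`, `kernel_hasSum`, `kernel_tsum` — **`K_λ(t, s) = Σ_k (μ − μ₂)^k K_{λ₂}^{∘(k+1)}(t, s)`** on the sharp disc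
  `|μ − μ₂| < (λ₂ − 1)²` (row 577);
* `kernel_second_order_eq`, `kernel_taylor_remainder` — **the exact second-order identity and the `Ξ`-weighted remainder**
  (row 578);
* `resolvent_congr_Ioi`, `iterate_congr_Ioi'`, `iterate_const_mul'`, `iterate_sub_ground'`, `kernel_source_sub` — the
  resolvent sees the source on `(0, ∞)` only, the iterates are linear on `W_1`, the kernel sources differ by
  `(μ − μ₂) G^I_λ K_{λ₂}(·, s)` (row 579);
* `kernel_comp_hasDerivAt_lam`, `kernel_comp_hasDerivAt_mu` — **`∂_μ K_μ^{∘(n+1)} = (n + 1) K_μ^{∘(n+2)}`** (rows 579–580);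
* `kernel_iteratedDeriv_mu`, `kernel_iteratedDeriv_mu'` — **`∂ᵏ_μ K_μ(t, s) = k! K_μ^{∘(k+1)}(t, s)`** (row 580).

Nothing is claimed about (N).

Blind lane: Mathlib + the HodgeRepro2 prefix only; no sorry; axioms ⊆ {propext, Classical.choice,
Quot.sound}.
-/

namespace Summit.Ventures.HodgeRepro2.T5SU11RadialSummaryXXI

open Filter Topology MeasureTheory
open Set (Ioi Ioc)
open T5SU11Cartan T5SU11SphericalFunction T5SU11SphericalDecay T5SU11RadialGreenKernel T5SU11RadialGreenImproper
  T5SU11KernelPowerSeries T5SU11KernelTaylor T5SU11KernelCompositionDerivative T5SU11KernelIteratedDerivative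

/-- **The resolvent only sees the source on `(0, ∞)`** (row 579). -/
theorem resolvent_congr_Ioi (φ χ : ℝ → ℝ) {f g : ℝ → ℝ} (hfg : ∀ r, 0 < r → f r = g r) {t : ℝ} (ht : 0 < t) :
    greenSolI φ χ f t = greenSolI φ χ g t :=
  greenSolI_congr_Ioi φ χ hfg ht

/-- **The iterates only see the source on `(0, ∞)`** (row 579). -/
theorem iterate_congr_Ioi' (φ χ : ℝ → ℝ) {f g : ℝ → ℝ} (hfg : ∀ r, 0 < r → f r = g r) (n : ℕ) :
    ∀ t, 0 < t → ((greenSolI φ χ)^[n] f) t = ((greenSolI φ χ)^[n] g) t :=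
  iterate_congr_Ioi φ χ hfg n

/-- **The iterates are homogeneous** (row 579). -/
theorem iterate_const_mul' (φ χ f : ℝ → ℝ) (c : ℝ) (n : ℕ) :
    (greenSolI φ χ)^[n] (fun r => c * f r) = fun t => c * ((greenSolI φ χ)^[n] f) t :=
  iterate_const_mul φ χ f c n

section measure

variable [MeasurableSpace Circle] [BorelSpace Circle]

variable {lam lam₂ : ℝ} (hlam : 1 < lam) (hlam₂ : 1 < lam₂) {s : ℝ} (hs : 0 < s)

include hlam₂ hs in
/-- **The kernel's Neumann series is absolutely summable** on the sharp disc (row 577). -/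
theorem kernel_summable (hq : |lam * (lam - 2) - lam₂ * (lam₂ - 2)| < (lam₂ - 1) ^ 2) {t : ℝ} (ht : 0 < t) :
    Summable (fun k : ℕ => (lam * (lam - 2) - lam₂ * (lam₂ - 2)) ^ k
      * ((greenSolI (fun t => sph lam₂ (hyp t)) (sphDecay lam₂))^[k] (fun r => sphGreenKernel lam₂ r s)) t) :=
  summable_kernel_neumann (lam := lam) hlam₂ hs hq ht

include hlam hlam₂ hs in
/-- **`K_λ(t, s) = Σ_k (μ − μ₂)^k K_{λ₂}^{∘(k+1)}(t, s)`** as a `HasSum` (row 577). -/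
theorem kernel_hasSum (hq : |lam * (lam - 2) - lam₂ * (lam₂ - 2)| < (lam₂ - 1) ^ 2) {t : ℝ} (ht : 0 < t) :
    HasSum (fun k : ℕ => (lam * (lam - 2) - lam₂ * (lam₂ - 2)) ^ k
      * ((greenSolI (fun t => sph lam₂ (hyp t)) (sphDecay lam₂))^[k] (fun r => sphGreenKernel lam₂ r s)) t)
      (sphGreenKernel lam t s) :=
  hasSum_kernel_neumann hlam hlam₂ hs hq ht

include hlam hlam₂ hs in
/-- **`∑' k, (μ − μ₂)^k K_{λ₂}^{∘(k+1)}(t, s) = K_λ(t, s)`** (row 577). -/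
theorem kernel_tsum (hq : |lam * (lam - 2) - lam₂ * (lam₂ - 2)| < (lam₂ - 1) ^ 2) {t : ℝ} (ht : 0 < t) :
    ∑' k : ℕ, (lam * (lam - 2) - lam₂ * (lam₂ - 2)) ^ k
      * ((greenSolI (fun t => sph lam₂ (hyp t)) (sphDecay lam₂))^[k] (fun r => sphGreenKernel lam₂ r s)) t
      = sphGreenKernel lam t s :=
  tsum_kernel_neumann hlam hlam₂ hs hq ht

include hlam hlam₂ hs in
/-- **The exact second-order identity of the kernel** (row 578). -/
theorem kernel_second_order_eq {t : ℝ} (ht : 0 < t) :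
    sphGreenKernel lam t s - sphGreenKernel lam₂ t s
        - (lam * (lam - 2) - lam₂ * (lam₂ - 2))
          * ∫ r in Ioi 0, sphGreenKernel lam₂ t r * sphGreenKernel lam₂ r s * Real.sinh (2 * r)
      = (lam * (lam - 2) - lam₂ * (lam₂ - 2)) ^ 2 * greenSolI (fun t => sph lam (hyp t)) (sphDecay lam)
          (greenSolI (fun t => sph lam₂ (hyp t)) (sphDecay lam₂) (fun r => sphGreenKernel lam₂ r s)) t :=
  kernel_sub_sub_eq hlam hlam₂ hs ht

include hlam hlam₂ hs in
/-- **The `Ξ`-weighted Taylor remainder of the kernel** (row 578). -/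
theorem kernel_taylor_remainder :
    ∃ D : ℝ, 0 ≤ D ∧ ∀ t, 0 < t →
      |sphGreenKernel lam t s - sphGreenKernel lam₂ t s
        - (lam * (lam - 2) - lam₂ * (lam₂ - 2))
          * ∫ r in Ioi 0, sphGreenKernel lam₂ t r * sphGreenKernel lam₂ r s * Real.sinh (2 * r)|
      ≤ (lam * (lam - 2) - lam₂ * (lam₂ - 2)) ^ 2 * D * sph 1 (hyp t) / ((lam - 1) ^ 2 * (lam₂ - 1) ^ 2) :=
  abs_kernel_sub_sub_le hlam hlam₂ hs

include hlam in
/-- **The iterates are additive on `W_1`** (row 579). -/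
theorem iterate_sub_ground' {f g : ℝ → ℝ} (hf : ContinuousOn f (Ioi 0)) (hg : ContinuousOn g (Ioi 0))
    {D₁ D₂ : ℝ} (hD₁ : ∀ s, 0 < s → |f s| ≤ D₁ * sph 1 (hyp s)) (hD₂ : ∀ s, 0 < s → |g s| ≤ D₂ * sph 1 (hyp s)) (n : ℕ) :
    ∀ t, 0 < t → ((greenSolI (fun t => sph lam (hyp t)) (sphDecay lam))^[n] (fun r => f r - g r)) t
      = ((greenSolI (fun t => sph lam (hyp t)) (sphDecay lam))^[n] f) t
        - ((greenSolI (fun t => sph lam (hyp t)) (sphDecay lam))^[n] g) t :=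
  iterate_sub_ground hlam hf hg hD₁ hD₂ n

include hlam hlam₂ hs in
/-- **The kernel sources differ by `(μ − μ₂) G^I_λ K_{λ₂}(·, s)`** (row 579). -/
theorem kernel_source_sub {r : ℝ} (hr : 0 < r) :
    sphGreenKernel lam r s - sphGreenKernel lam₂ r s
      = (lam * (lam - 2) - lam₂ * (lam₂ - 2))
        * greenSolI (fun t => sph lam (hyp t)) (sphDecay lam) (fun r => sphGreenKernel lam₂ r s) r :=
  kernel_source_sub_eq hlam hlam₂ hs hr

include hlam hs in
/-- **The derivative of the composed kernels in `λ`** (row 579). -/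
theorem kernel_comp_hasDerivAt_lam (n : ℕ) {t : ℝ} (ht : 0 < t) :
    HasDerivAt (fun l => ((greenSolI (fun t => sph l (hyp t)) (sphDecay l))^[n] (fun r => sphGreenKernel l r s)) t)
      ((2 * lam - 2) * ((n + 1 : ℕ) * ((greenSolI (fun t => sph lam (hyp t)) (sphDecay lam))^[n + 1]
        (fun r => sphGreenKernel lam r s)) t)) lam :=
  hasDerivAt_kernel_comp_lam hlam hs n ht

include hs in
/-- **`∂_μ K_μ^{∘(n+1)} = (n + 1) K_μ^{∘(n+2)}`** (row 580). -/
theorem kernel_comp_hasDerivAt_mu (n : ℕ) {μ₂ : ℝ} (hμ₂ : -1 < μ₂) {t : ℝ} (ht : 0 < t) :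
    HasDerivAt (fun μ => ((greenSolI (fun t => sph (1 + Real.sqrt (μ + 1)) (hyp t))
        (sphDecay (1 + Real.sqrt (μ + 1))))^[n] (fun r => sphGreenKernel (1 + Real.sqrt (μ + 1)) r s)) t)
      ((n + 1 : ℕ) * ((greenSolI (fun t => sph (1 + Real.sqrt (μ₂ + 1)) (hyp t))
        (sphDecay (1 + Real.sqrt (μ₂ + 1))))^[n + 1] (fun r => sphGreenKernel (1 + Real.sqrt (μ₂ + 1)) r s)) t) μ₂ :=
  hasDerivAt_kernel_comp_mu hs n hμ₂ ht

include hs in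
/-- **`∂ᵏ_μ K_μ(t, s) = k! K_μ^{∘(k+1)}(t, s)`** (row 580). -/
theorem kernel_iteratedDeriv_mu (k : ℕ) {μ₂ : ℝ} (hμ₂ : -1 < μ₂) {t : ℝ} (ht : 0 < t) :
    iteratedDeriv k (fun μ => sphGreenKernel (1 + Real.sqrt (μ + 1)) t s) μ₂
      = (k.factorial : ℝ) * ((greenSolI (fun t => sph (1 + Real.sqrt (μ₂ + 1)) (hyp t))
        (sphDecay (1 + Real.sqrt (μ₂ + 1))))^[k] (fun r => sphGreenKernel (1 + Real.sqrt (μ₂ + 1)) r s)) t :=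
  iteratedDeriv_kernel_mu hs k hμ₂ ht

include hlam hs in
/-- **`∂ᵏ_μ K_μ(t, s) = k! K_μ^{∘(k+1)}(t, s)` at `μ = λ(λ − 2)`** (row 580). -/
theorem kernel_iteratedDeriv_mu' (k : ℕ) {t : ℝ} (ht : 0 < t) :
    iteratedDeriv k (fun μ => sphGreenKernel (1 + Real.sqrt (μ + 1)) t s) (lam * (lam - 2))
      = (k.factorial : ℝ) * ((greenSolI (fun t => sph lam (hyp t)) (sphDecay lam))^[k]
        (fun r => sphGreenKernel lam r s)) t :=
  iteratedDeriv_kernel_mu' hs k hlam ht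

end measure

end Summit.Ventures.HodgeRepro2.T5SU11RadialSummaryXXI
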